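import Summits.ResolutionOfSingularities.ResolutionOfSingularities.Theorems.HomologicalConductorNoZenoRQuadraticTransformNonContracted
import Summits.ResolutionOfSingularities.ResolutionOfSingularities.Theorems.HomologicalConductorNoZenoRHomExt
import Literature.AlgebraicGeometry.Resolution.BlowupsIntegral
import Literature.AlgebraicGeometry.Resolution.BlowupsProperProofs
import HarnessLib

/-!
# Crux `NoZenoR` (stmt-ResolutionOfSingularities-19943) — the minimal desingularization of a rational surface
# singularity IS the minimal desingularization of its quadratic transform (first half of [U] of the Castelnuovo-free road)

Route `ResolutionOfSingularities/HomologicalConductor` (cell decomp-res, hand leafhand-res-homologicalconduct-24 g0).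
OURS: AI-written proof over tree theorems, weaker than expert review; nothing here is a statement of the manuscript
under review (Hironaka 2017).  SUPPORT level, counted 0.  Def-free, fact-free.

* **`isMinimalResolution_of_fac_isBlowup`** — `π : X → Spec S` a MINIMAL desingularization (universal property), `b : V → Spec S`
  a blowing up of a non-zero ideal sheaf (e.g. of `𝔪`), `σ : X → V` a desingularization with `σ ≫ b = π`: then `σ` is a
  MINIMAL desingularization of `V`.  Every desingularization `ρ : Y → V` gives a desingularization `ρ ≫ b` of `Spec S`,
  hence `m : Y → X` with `m ≫ π = ρ ≫ b`; and `m ≫ σ = ρ` by rigidity of morphisms over the base between birational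
  models (`FirstKind.hom_ext_of_isBirational`, hand 18).
* `exists_isMinimalResolution_fac_affineBlowup` — for a NON-regular rational `S`: the minimal desingularization `X`
  of `Spec S` dominates `Bl_𝔪 Spec S` (Lipman (*), p. 203) by a MINIMAL desingularization `σ` of `Bl_𝔪 Spec S`.

What remains of [U] (memo MEMO-19943-hand24g0-M0-ROAD.md): minimality of the base change of `σ` to `Spec 𝒪_{V,v}`
(via the `Bl_J` description of minimal desingularizations of normal surfaces, hand 16 g4 / 22).
No crux or summit statement is proved here.
-/

noncomputable section

-- single-problem summit: the doubled namespace component `ResolutionOfSingularities` is forced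
set_option linter.dupNamespace false

open CategoryTheory CategoryTheory.Limits AlgebraicGeometry TopologicalSpace IsLocalRing
open Literature.AlgebraicGeometry Literature.AlgebraicGeometry.Resolution

namespace Summit.ResolutionOfSingularities.ResolutionOfSingularities.Theorems.NoZeno.FirstKind

variable {S : Type} [CommRing S] [IsNoetherianRing S] [IsLocalRing S] [IsDomain S] [IsIntegrallyClosed S]
  {X : Scheme.{0}} (π : X ⟶ Spec (.of S))

omit [IsLocalRing S] [IsIntegrallyClosed S] in
/-- **A minimal desingularization of `Spec S` dominating a blowing up `V → Spec S` is a minimal desingularization of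
`V`.**  `π : X → Spec S` minimal (every desingularization of `Spec S` factors through `π`), `b : V → Spec S` a blowing
up along a non-zero ideal sheaf, `σ : X → V` a desingularization with `σ ≫ b = π` ⇒ `IsMinimalResolution σ`.
[cite: Lipman1969, Theorem (4.1) (p. 204); Badescu2001, Prop. 4.5] -/
theorem isMinimalResolution_of_fac_isBlowup (hπ : IsMinimalResolution π) {V : Scheme.{0}} {b : V ⟶ Spec (.of S)}
    {J : (Spec (.of S)).IdealSheafData} (hb : IsBlowup b J) (hJ : J ≠ ⊥) (σ : X ⟶ V) (hσ : σ ≫ b = π)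
    (hσres : IsResolution σ) : IsMinimalResolution σ := by
  haveI : IsIntegral V := hb.isIntegral hJ
  haveI : IsProper b := hb.isProper
  have hbir : IsBirational b := hb.isBirational' hJ
  refine ⟨hσres, fun Y ρ hρ => ?_⟩
  haveI : IsIntegral Y := hρ.isIntegral_source
  haveI : IsProper ρ := hρ.isProper
  -- `ρ ≫ b` is a desingularization of `Spec S`, so it factors through the minimal `π`
  have hρb : IsResolution (ρ ≫ b) := ⟨inferInstance, hρ.isBirational.comp hbir, hρ.isRegular⟩
  obtain ⟨m, hm⟩ := hπ.2 Y (ρ ≫ b) hρb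
  refine ⟨m, ?_⟩
  -- rigidity over `Spec S`: `m ≫ σ` and `ρ` agree after `b`
  have e : (m ≫ σ) ≫ b = ρ ≫ b := by rw [Category.assoc, hσ, hm]
  exact hom_ext_of_isBirational b hbir (by rw [e]; exact hρb.isBirational) e

/-- **The minimal desingularization of a NON-regular rational `S` is a MINIMAL desingularization of the quadratic
transform `Bl_𝔪 Spec S`** through Lipman's domination (*) (p. 203): there is `σ : X → Bl_𝔪 Spec S` with
`σ ≫ (Bl_𝔪 → Spec S) = π`, `IsResolution σ` and `IsMinimalResolution σ`.
[cite: Lipman1969, Section 2, (*) (p. 203); Theorem (4.1) (p. 204)] -/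
theorem exists_isMinimalResolution_fac_affineBlowup (hdim : ringKrullDim S = 2) (hrat : HasRationalSingularity S)
    (hsing : ¬ IsRegularLocalRing S) (hπ : IsMinimalResolution π) :
    ∃ σ : X ⟶ affineBlowup (maximalIdeal S), σ ≫ affineBlowup.π (maximalIdeal S) = π ∧ IsMinimalResolution σ := by
  obtain ⟨σ, hσ, hσres⟩ := QuadraticTransform.exists_isResolution_fac_of_isBlowup_maximalIdeal π hdim hrat hsing hπ.1
    (affineBlowup.isBlowup (maximalIdeal S))
  have hI0 : affineBlowup.idealSheaf (maximalIdeal S) ≠ ⊥ := by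
    intro h
    apply QuadraticTransform.baseIdeal_maximalIdeal_ne_bot π hdim hπ.1
    rw [← ExcCount.comap_affineBlowupIdealSheaf_eq_baseIdeal, h, Scheme.IdealSheafData.comap_bot]
  exact ⟨σ, hσ, isMinimalResolution_of_fac_isBlowup π hπ (affineBlowup.isBlowup _) hI0 σ hσ hσres⟩

end Summit.ResolutionOfSingularities.ResolutionOfSingularities.Theorems.NoZeno.FirstKind

end
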